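import Summits.QuantumFields.YangMills.Theorems.IR.EsPolymerEngineKCofinal
import Summits.QuantumFields.YangMills.Theorems.IR.EsPolymerESRungK
import HarnessLib

/-!
# Crux `IR` RE-TYPED: leaf `IRcof` (stmt-QuantumFields-26930; supplier item `IR` stmt-QuantumFields-19354) — line
«es-polymer-decoupling» (ideator ym-ir-idea-1; lead prover ym-ir-line-mxc-p1), COFINAL RE-CUT

Lead prover ym-ir-line-mxc-p1 g5 (2026-08-28), answering director-ym №25 (2).  Companion of the skeleton of record for the old
leaf, `Lines/es_polymer_decoupling.lean` v5 (concludes `Theses.BalabanLadder.IR` from the load of record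
`stub_polymerCertK : IRPolymerCertK`).  NOT a registry write (g9-№1 / №27 (2)); published with `crux write`.

RE-PRICED: **WALL UNCHANGED.**  The only open statement was and is the XL load — a disjoint-polymer representation `DPRk` of the
torus Wilson states at a physical mesh `⌈ℓ/a(β)⌉` with Peierls parameter `p` AT a large coupling, on all large tori (the
weak-coupling polymer/cluster representation of 4-d lattice Yang–Mills at scale `ℓ/a(β)`; EQUIV-or-stronger; simplicity
load-bearing; literature-open).  The ENGINE IS PER-COUPLING (tree `EngineK.gapOn_of_DPRkOn`): under the re-typing the load drops
to its COFINAL form `IRPolymerCertKCof` («`LowerBounds` ⇒ for every `p > 0`, on SOME set of couplings unbounded above, `DPRk` at a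
physical mesh on all large tori») and the line closes `IRcof` modulo that ONE stub, by name (`IRcof_of`).  Tree theorems used:
`EngineK.gapOn_of_DPRkOn`, `EngineK.ircof_of_polymerCertKCof`, `EngineK.polymerCertKCof_of_irPolymerCertK`
(`Theorems/IR/EsPolymerEngineKCofinal.lean`), engine `EngineK.polymerEngineK` p608147, rung `stub_esRungK` (`Theorems/IR/EsPolymerESRungK.lean`).

HONEST FRAMING: CONDITIONAL rung line; the ONE `sorry` below is the XL load (NOT staffed, R366 (i)); `BalabanLadder.IRcof` /
`IR` NOT proved; the Clay YM mass gap NOT proved; R4 closes only the finite-𝕋⁴ UV rung `BalabanLadder.UV`.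
-/
set_option autoImplicit false

noncomputable section

open Filter Topology MeasureTheory
open Literature.MathematicalPhysics.QuantumFieldTheory Literature.MathematicalPhysics.QuantumLattice
open Summit.QuantumFields.YangMills.Cruxes.OSLegsFromFemtoAndGap.DlrCollarTransfer (GapInUnits LowerBounds)

namespace Summit.QuantumFields.YangMills.Cruxes.IR.EsPolymer

/-- **THE COFINAL LOAD (XL — NOT staffed).**  For compact SIMPLE `G`: non-triviality in units `a` forces, for EVERY Peierls
parameter `p > 0`, a set of couplings `Bset` UNBOUNDED ABOVE (depending on `p`) and a physical mesh `ℓ > 0` such that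
`DPRk r.ρ β S ⌈ℓ / a β⌉₊ p` holds for `β ∈ Bset`, `β ≥ β₂`, `S ≥ S₁ β`.  `Bset = univ` is the load of record `IRPolymerCertK`;
this is the hypothesis of the tree composition `EngineK.ircof_of_polymerCertKCof`, verbatim. -/
def IRPolymerCertKCof : Prop :=
  ∀ (G : Type) [Group G] [TopologicalSpace G] [IsTopologicalGroup G] [CompactSpace G],
    IsCompactSimpleLieGroup G → letI : MeasurableSpace G := borel G; haveI : BorelSpace G := ⟨rfl⟩;
    ∀ (r : LatticeRep G) (a : ℝ → ℝ), (∀ β, 0 < a β) → Tendsto a atTop (𝓝 0) → LowerBounds G r a →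
      ∀ p : ℝ, 0 < p → ∃ Bset : Set ℝ, (∀ x : ℝ, ∃ β ∈ Bset, x ≤ β) ∧
        ∃ (ℓ β₂ : ℝ) (S₁ : ℝ → ℕ), 0 < ℓ ∧
          ∀ β ∈ Bset, β₂ ≤ β → ∀ S : ℕ, S₁ β ≤ S → DPRk r.ρ β S ⌈ℓ / a β⌉₊ p

/-- STUB — THE COFINAL LOAD (XL; the ONLY `sorry` of this skeleton; NOT staffed per R366 (i)). -/
theorem stub_polymerCertKCof : IRPolymerCertKCof := by
  sorry

/-- The load of record implies the cofinal load (tree `EngineK.polymerCertKCof_of_irPolymerCertK`, `Bset = univ`). -/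
theorem irPolymerCertKCof_of_irPolymerCertK (hC : IRPolymerCertK) : IRPolymerCertKCof :=
  EngineK.polymerCertKCof_of_irPolymerCertK hC

-- the landed stubs of the line (unchanged by the re-typing), cited by name
example : PolymerEngineK := EngineK.polymerEngineK
example : ESRungK := stub_esRungK

/-- **The line concludes the RE-TYPED route decl BY NAME:** cofinal load + engine on its coupling set ⇒ `IRcof`
(tree `EngineK.ircof_of_polymerCertKCof`, whose engine half `EngineK.gapOn_of_DPRkOn` is proved). -/
theorem IRcof_of : Summit.QuantumFields.YangMills.Theses.BalabanLadder.IRcof :=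
  EngineK.ircof_of_polymerCertKCof stub_polymerCertKCof

end Summit.QuantumFields.YangMills.Cruxes.IR.EsPolymer

end
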